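import Literature.Analysis.OperatorTheory.HilbertSchmidtPartialSums
import HarnessLib

/-!
# The Hilbert–Schmidt pairing `Σ_i ⟨A e_i, B e_i⟩`: absolute convergence, the adjoint form
# `Σ_k ⟨B† f_k, A† f_k⟩`, and independence of the Hilbert basis (Reed–Simon I, Thm. VI.22 (c)–(e), VI.24)

Topic `Literature/Analysis/OperatorTheory`; theorems only (no definition, no named fact, no instance);
continuation of `HilbertSchmidtOrthogonalSum.lean` / `HilbertSchmidtPartialSums.lean`.  Mathlib has no
trace class; as in those files, "`A` is Hilbert–Schmidt" is typed as the convergence of `Σ_i ‖A e_i‖²` along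
a Hilbert basis.  For TWO such operators `A, B : E → F` the product `A† B` is trace class and its trace is
the Hilbert–Schmidt inner product `⟨A, B⟩₂ = Σ_i ⟨A e_i, B e_i⟩` (Reed–Simon I, Thm. VI.22 (e): `𝒥₂` is a
Hilbert space for `⟨A, B⟩₂ = Σ ⟨A φ_n, B φ_n⟩`; Thm. VI.24: "`tr` is independent of the basis").  This
file proves the corresponding bookkeeping WITHOUT trace-class theory:

* `summable_norm_mul_norm_of_sq`, `summable_inner_of_summable_norm_sq`, `norm_tsum_inner_le` — if
  `Σ_i ‖A e_i‖²` and `Σ_i ‖B e_i‖²` converge then `Σ_i ⟨A e_i, B e_i⟩` converges absolutely, with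
  `|Σ_i ⟨A e_i, B e_i⟩| ≤ Σ_i ‖A e_i‖‖B e_i‖ ≤ (Σ_i ‖A e_i‖² + Σ_i ‖B e_i‖²)/2`;
* `hasSum_inner_apply_apply_and_adjoint` — **the adjoint form**: `Σ_i ⟨A e_i, B e_i⟩ = Σ_k ⟨B† f_k, A† f_k⟩`
  for any Hilbert bases `(e_i)` of `E`, `(f_k)` of `F` (Parseval twice; the double family
  `⟨A e_i, f_k⟩⟨f_k, B e_i⟩` is absolutely summable by Bessel);
* `tsum_inner_apply_apply_eq_of_hilbertBasis` — **the pairing does not depend on the Hilbert basis**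
  (Reed–Simon I, Thm. VI.24 for `A† B`); `tsum_inner_apply_apply_eq_of_hilbertBasis_of_mem` — the same
  inside a closed subspace `V` (the "compressed trace" `Σ_j ⟨A b_j, B b_j⟩` over Hilbert bases of `V`).

Written for the cell `rh-crit` (Connes 1999 §VII semilocal trace formula: the diagonal series of
`ϑ(g) P̂_Λ Q₀ …` along Hilbert bases of `L²(ℝ)_ev` are such pairings of Hilbert–Schmidt factors); RH-free.

## References
* M. Reed, B. Simon, *Methods of Modern Mathematical Physics I: Functional Analysis* (1972), Thm. VI.22
  (c)–(e) and Thm. VI.24 (PDF pp. 198–199 of the held copy). [ReedSimon1972]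
-/

noncomputable section

open Filter
open scoped InnerProductSpace Topology

namespace Literature.Analysis.OperatorTheory

variable {𝕜 : Type*} [RCLike 𝕜]
variable {E F : Type*} [NormedAddCommGroup E] [InnerProductSpace 𝕜 E] [CompleteSpace E]
  [NormedAddCommGroup F] [InnerProductSpace 𝕜 F] [CompleteSpace F]

/-! ## Absolute convergence of the pairing -/

section Absolute

omit [CompleteSpace F] in
/-- `‖u‖‖v‖ ≤ (‖u‖² + ‖v‖²)/2`; hence `Σ ‖u_i‖‖v_i‖` converges when `Σ‖u_i‖²`, `Σ‖v_i‖²` do. [cite: ReedSimon1972, Thm. VI.22 (c), PDF p. 198] -/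
theorem summable_norm_mul_norm_of_sq {ι : Type*} {u v : ι → F} (hu : Summable fun i => ‖u i‖ ^ 2)
    (hv : Summable fun i => ‖v i‖ ^ 2) : Summable fun i => ‖u i‖ * ‖v i‖ := by
  refine Summable.of_nonneg_of_le (fun _ => mul_nonneg (norm_nonneg _) (norm_nonneg _))
    (fun i => ?_) ((hu.add hv).div_const 2)
  have h := two_mul_le_add_sq ‖u i‖ ‖v i‖
  change ‖u i‖ * ‖v i‖ ≤ (‖u i‖ ^ 2 + ‖v i‖ ^ 2) / 2
  linarith

omit [CompleteSpace F] in
/-- The bound `Σ ‖u_i‖‖v_i‖ ≤ (Σ‖u_i‖² + Σ‖v_i‖²)/2`. [cite: ReedSimon1972, Thm. VI.22 (c), PDF p. 198] -/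
theorem tsum_norm_mul_norm_le {ι : Type*} {u v : ι → F} (hu : Summable fun i => ‖u i‖ ^ 2)
    (hv : Summable fun i => ‖v i‖ ^ 2) :
    ∑' i, ‖u i‖ * ‖v i‖ ≤ ((∑' i, ‖u i‖ ^ 2) + ∑' i, ‖v i‖ ^ 2) / 2 := by
  rw [← hu.tsum_add hv, ← tsum_div_const]
  refine (summable_norm_mul_norm_of_sq hu hv).tsum_le_tsum (fun i => ?_) ((hu.add hv).div_const 2)
  have h := two_mul_le_add_sq ‖u i‖ ‖v i‖
  change ‖u i‖ * ‖v i‖ ≤ (‖u i‖ ^ 2 + ‖v i‖ ^ 2) / 2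
  linarith

omit [CompleteSpace F] in
/-- **`Σ_i ⟨u_i, v_i⟩` converges absolutely when `Σ‖u_i‖²` and `Σ‖v_i‖²` converge** (Cauchy–Schwarz
termwise). [cite: ReedSimon1972, Thm. VI.22 (c), (e), PDF p. 198] -/
theorem summable_inner_of_summable_norm_sq {ι : Type*} {u v : ι → F} (hu : Summable fun i => ‖u i‖ ^ 2)
    (hv : Summable fun i => ‖v i‖ ^ 2) : Summable fun i => ⟪u i, v i⟫_𝕜 :=
  Summable.of_norm_bounded (summable_norm_mul_norm_of_sq hu hv) fun _ => norm_inner_le_norm _ _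

omit [CompleteSpace F] in
/-- **`|Σ_i ⟨u_i, v_i⟩| ≤ Σ_i ‖u_i‖‖v_i‖`.** [cite: ReedSimon1972, Thm. VI.22 (c), (e), PDF p. 198] -/
theorem norm_tsum_inner_le {ι : Type*} {u v : ι → F} (hu : Summable fun i => ‖u i‖ ^ 2)
    (hv : Summable fun i => ‖v i‖ ^ 2) : ‖∑' i, ⟪u i, v i⟫_𝕜‖ ≤ ∑' i, ‖u i‖ * ‖v i‖ :=
  tsum_of_norm_bounded (summable_norm_mul_norm_of_sq hu hv).hasSum fun _ => norm_inner_le_norm _ _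

omit [CompleteSpace E] [CompleteSpace F] in
/-- For bounded `A, B : E → F` Hilbert–Schmidt along a Hilbert basis `(e_i)`, the pairing
`Σ_i ⟨A e_i, B e_i⟩` converges absolutely. [cite: ReedSimon1972, Thm. VI.22 (e), PDF p. 198] -/
theorem summable_inner_apply_apply {ι : Type*} (b : HilbertBasis ι 𝕜 E) (A B : E →L[𝕜] F)
    (hA : Summable fun i => ‖A (b i)‖ ^ 2) (hB : Summable fun i => ‖B (b i)‖ ^ 2) :
    Summable fun i => ⟪A (b i), B (b i)⟫_𝕜 :=
  summable_inner_of_summable_norm_sq hA hB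

end Absolute

/-! ## The adjoint form and independence of the basis -/

section Adjoint

omit [CompleteSpace E] [CompleteSpace F] in
/-- The double family `(i,k) ↦ ⟨A e_i, f_k⟩ ⟨f_k, B e_i⟩` is absolutely summable when `A`, `B` are
Hilbert–Schmidt along `(e_i)` (Bessel: `Σ_k |⟨A e_i, f_k⟩|² = ‖A e_i‖²`). [cite: ReedSimon1972, Thm. VI.22 (e), PDF p. 198] -/
theorem summable_inner_mul_inner_prod {ι κ : Type*} (b : HilbertBasis ι 𝕜 E) (c : HilbertBasis κ 𝕜 F)
    (A B : E →L[𝕜] F) (hA : Summable fun i => ‖A (b i)‖ ^ 2) (hB : Summable fun i => ‖B (b i)‖ ^ 2) :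
    Summable fun ik : ι × κ => ⟪A (b ik.1), c ik.2⟫_𝕜 * ⟪c ik.2, B (b ik.1)⟫_𝕜 := by
  -- dominate by `(|⟨c_k, A e_i⟩|² + |⟨c_k, B e_i⟩|²)/2`, summable over `ι × κ`
  have hdom : Summable fun ik : ι × κ => (‖⟪c ik.2, A (b ik.1)⟫_𝕜‖ ^ 2 + ‖⟪c ik.2, B (b ik.1)⟫_𝕜‖ ^ 2) / 2 := by
    refine Summable.div_const ?_ 2
    have h1 : Summable fun ik : ι × κ => ‖⟪c ik.2, A (b ik.1)⟫_𝕜‖ ^ 2 := by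
      refine (summable_prod_of_nonneg fun _ => by positivity).2 ⟨fun i => (hasSum_norm_inner_sq c (A (b i))).summable, ?_⟩
      refine hA.congr fun i => ?_
      exact ((hasSum_norm_inner_sq c (A (b i))).tsum_eq).symm
    have h2 : Summable fun ik : ι × κ => ‖⟪c ik.2, B (b ik.1)⟫_𝕜‖ ^ 2 := by
      refine (summable_prod_of_nonneg fun _ => by positivity).2 ⟨fun i => (hasSum_norm_inner_sq c (B (b i))).summable, ?_⟩
      refine hB.congr fun i => ?_
      exact ((hasSum_norm_inner_sq c (B (b i))).tsum_eq).symm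
    exact h1.add h2
  refine Summable.of_norm_bounded hdom fun ik => ?_
  rw [norm_mul, ← inner_conj_symm (A (b ik.1)) (c ik.2), RCLike.norm_conj]
  have h := two_mul_le_add_sq ‖⟪c ik.2, A (b ik.1)⟫_𝕜‖ ‖⟪c ik.2, B (b ik.1)⟫_𝕜‖
  linarith

/-- **The Hilbert–Schmidt pairing and its adjoint form have the same sum**: there is `s` with
`Σ_i ⟨A e_i, B e_i⟩ = s = Σ_k ⟨B† f_k, A† f_k⟩`, both `HasSum`, for any Hilbert bases `(e_i)` of `E`
and `(f_k)` of `F` (Parseval in `F` rows, Parseval in `E` columns, Fubini for the absolutely summable double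
family). [cite: ReedSimon1972, Thm. VI.22 (e) and Thm. VI.24, PDF pp. 198–199] -/
theorem hasSum_inner_apply_apply_and_adjoint {ι κ : Type*} (b : HilbertBasis ι 𝕜 E) (c : HilbertBasis κ 𝕜 F)
    (A B : E →L[𝕜] F) (hA : Summable fun i => ‖A (b i)‖ ^ 2) (hB : Summable fun i => ‖B (b i)‖ ^ 2) :
    ∃ s : 𝕜, HasSum (fun i => ⟪A (b i), B (b i)⟫_𝕜) s ∧
      HasSum (fun k => ⟪ContinuousLinearMap.adjoint B (c k), ContinuousLinearMap.adjoint A (c k)⟫_𝕜) s := by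
  have hF := summable_inner_mul_inner_prod b c A B hA hB
  set s := ∑' ik : ι × κ, ⟪A (b ik.1), c ik.2⟫_𝕜 * ⟪c ik.2, B (b ik.1)⟫_𝕜 with hs
  have hFs : HasSum (fun ik : ι × κ => ⟪A (b ik.1), c ik.2⟫_𝕜 * ⟪c ik.2, B (b ik.1)⟫_𝕜) s := hF.hasSum
  refine ⟨s, ?_, ?_⟩
  · -- rows: `Σ_k ⟨A e_i, f_k⟩⟨f_k, B e_i⟩ = ⟨A e_i, B e_i⟩`
    exact hFs.prod_fiberwise fun i => c.hasSum_inner_mul_inner (A (b i)) (B (b i))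
  · -- columns: `Σ_i ⟨A e_i, f_k⟩⟨f_k, B e_i⟩ = Σ_i ⟨B† f_k, e_i⟩⟨e_i, A† f_k⟩ = ⟨B† f_k, A† f_k⟩`
    have hF' : HasSum (fun ki : κ × ι => ⟪A (b ki.2), c ki.1⟫_𝕜 * ⟪c ki.1, B (b ki.2)⟫_𝕜) s :=
      (Equiv.prodComm ι κ).symm.hasSum_iff.2 hFs
    refine hF'.prod_fiberwise fun k => ?_
    have h := b.hasSum_inner_mul_inner (ContinuousLinearMap.adjoint B (c k)) (ContinuousLinearMap.adjoint A (c k))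
    refine h.congr_fun fun i => ?_
    rw [ContinuousLinearMap.adjoint_inner_left, ContinuousLinearMap.adjoint_inner_right, mul_comm]

/-- **`Σ_i ⟨A e_i, B e_i⟩ = Σ_k ⟨B† f_k, A† f_k⟩`** (tsum form). [cite: ReedSimon1972, Thm. VI.22 (e) and Thm. VI.24, PDF pp. 198–199] -/
theorem tsum_inner_apply_apply_eq_tsum_adjoint {ι κ : Type*} (b : HilbertBasis ι 𝕜 E) (c : HilbertBasis κ 𝕜 F)
    (A B : E →L[𝕜] F) (hA : Summable fun i => ‖A (b i)‖ ^ 2) (hB : Summable fun i => ‖B (b i)‖ ^ 2) :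
    ∑' i, ⟪A (b i), B (b i)⟫_𝕜 =
      ∑' k, ⟪ContinuousLinearMap.adjoint B (c k), ContinuousLinearMap.adjoint A (c k)⟫_𝕜 := by
  obtain ⟨s, h1, h2⟩ := hasSum_inner_apply_apply_and_adjoint b c A B hA hB
  rw [h1.tsum_eq, h2.tsum_eq]

/-- **The Hilbert–Schmidt pairing does not depend on the Hilbert basis** (Reed–Simon I, Thm. VI.24 for the
trace-class operator `A† B`): `Σ_i ⟨A e_i, B e_i⟩ = Σ_j ⟨A e'_j, B e'_j⟩` for any two Hilbert bases of `E`,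
`A`, `B` Hilbert–Schmidt along the first (hence along the second). [cite: ReedSimon1972, Thm. VI.24, PDF p. 199] -/
theorem tsum_inner_apply_apply_eq_of_hilbertBasis {ι ι' : Type*} (b : HilbertBasis ι 𝕜 E)
    (b' : HilbertBasis ι' 𝕜 E) (A B : E →L[𝕜] F) (hA : Summable fun i => ‖A (b i)‖ ^ 2)
    (hB : Summable fun i => ‖B (b i)‖ ^ 2) :
    ∑' i, ⟪A (b i), B (b i)⟫_𝕜 = ∑' j, ⟪A (b' j), B (b' j)⟫_𝕜 := by
  obtain ⟨w, c, -⟩ := exists_hilbertBasis 𝕜 F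
  have hA' : Summable fun j => ‖A (b' j)‖ ^ 2 := (hasSum_norm_sq_apply_of_hasSum b b' A hA.hasSum).summable
  have hB' : Summable fun j => ‖B (b' j)‖ ^ 2 := (hasSum_norm_sq_apply_of_hasSum b b' B hB.hasSum).summable
  rw [tsum_inner_apply_apply_eq_tsum_adjoint b c A B hA hB, tsum_inner_apply_apply_eq_tsum_adjoint b' c A B hA' hB']

/-- The `HasSum` form of basis independence: if `Σ_i ⟨A e_i, B e_i⟩ = s` along one Hilbert basis then along
every Hilbert basis. [cite: ReedSimon1972, Thm. VI.24, PDF p. 199] -/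
theorem hasSum_inner_apply_apply_of_hasSum {ι ι' : Type*} (b : HilbertBasis ι 𝕜 E)
    (b' : HilbertBasis ι' 𝕜 E) (A B : E →L[𝕜] F) (hA : Summable fun i => ‖A (b i)‖ ^ 2)
    (hB : Summable fun i => ‖B (b i)‖ ^ 2) {s : 𝕜} (hs : HasSum (fun i => ⟪A (b i), B (b i)⟫_𝕜) s) :
    HasSum (fun j => ⟪A (b' j), B (b' j)⟫_𝕜) s := by
  have hA' : Summable fun j => ‖A (b' j)‖ ^ 2 := (hasSum_norm_sq_apply_of_hasSum b b' A hA.hasSum).summable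
  have hB' : Summable fun j => ‖B (b' j)‖ ^ 2 := (hasSum_norm_sq_apply_of_hasSum b b' B hB.hasSum).summable
  have h := (summable_inner_apply_apply b' A B hA' hB').hasSum
  rwa [← tsum_inner_apply_apply_eq_of_hilbertBasis b b' A B hA hB, hs.tsum_eq] at h

end Adjoint

/-! ## Compressed pairings: Hilbert bases of a closed subspace -/

section Subspace

variable {V : Submodule 𝕜 E} [CompleteSpace V]

omit [CompleteSpace E] in
/-- **Inside a closed subspace**: the compressed pairing `Σ_j ⟨A b_j, B b_j⟩` over Hilbert bases `(b_j)` of a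
closed subspace `V ≤ E` does not depend on the basis of `V` (apply the previous results to `A ∘ ι_V`,
`B ∘ ι_V : V → F`). [cite: ReedSimon1972, Thm. VI.24, PDF p. 199] -/
theorem tsum_inner_apply_apply_eq_of_hilbertBasis_of_mem {ι ι' : Type*} (bV : HilbertBasis ι 𝕜 V)
    (bV' : HilbertBasis ι' 𝕜 V) (A B : E →L[𝕜] F) (hA : Summable fun i => ‖A (bV i : E)‖ ^ 2)
    (hB : Summable fun i => ‖B (bV i : E)‖ ^ 2) :
    ∑' i, ⟪A (bV i : E), B (bV i : E)⟫_𝕜 = ∑' j, ⟪A (bV' j : E), B (bV' j : E)⟫_𝕜 := by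
  have h := tsum_inner_apply_apply_eq_of_hilbertBasis bV bV' (A ∘L V.subtypeL) (B ∘L V.subtypeL)
    (by simpa only [ContinuousLinearMap.comp_apply, Submodule.subtypeL_apply] using hA)
    (by simpa only [ContinuousLinearMap.comp_apply, Submodule.subtypeL_apply] using hB)
  simpa only [ContinuousLinearMap.comp_apply, Submodule.subtypeL_apply] using h

omit [CompleteSpace E] in
/-- The compressed pairing converges absolutely along every Hilbert basis of `V` once `A`, `B` are
Hilbert–Schmidt along one. [cite: ReedSimon1972, Thm. VI.22 (e), PDF p. 198] -/
theorem summable_inner_apply_apply_of_mem {ι ι' : Type*} (bV : HilbertBasis ι 𝕜 V)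
    (bV' : HilbertBasis ι' 𝕜 V) (A B : E →L[𝕜] F) (hA : Summable fun i => ‖A (bV i : E)‖ ^ 2)
    (hB : Summable fun i => ‖B (bV i : E)‖ ^ 2) :
    Summable fun j => ⟪A (bV' j : E), B (bV' j : E)⟫_𝕜 := by
  have hA' : Summable fun j => ‖(A ∘L V.subtypeL) (bV' j)‖ ^ 2 :=
    (hasSum_norm_sq_apply_of_hasSum bV bV' (A ∘L V.subtypeL)
      (by simpa only [ContinuousLinearMap.comp_apply, Submodule.subtypeL_apply] using hA.hasSum)).summable
  have hB' : Summable fun j => ‖(B ∘L V.subtypeL) (bV' j)‖ ^ 2 :=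
    (hasSum_norm_sq_apply_of_hasSum bV bV' (B ∘L V.subtypeL)
      (by simpa only [ContinuousLinearMap.comp_apply, Submodule.subtypeL_apply] using hB.hasSum)).summable
  simpa only [ContinuousLinearMap.comp_apply, Submodule.subtypeL_apply] using
    summable_inner_apply_apply bV' (A ∘L V.subtypeL) (B ∘L V.subtypeL) hA' hB'

/-- **Diagonal series of a product `A† B` along a Hilbert basis of `V`**: `Σ_j ⟨b_j, A† B b_j⟩ = Σ_j ⟨A b_j, B b_j⟩`
converges absolutely and does not depend on the Hilbert basis of `V` — the form in which "`Tr_V(A† B)`" is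
used when `A`, `B` are Hilbert–Schmidt factors. [cite: ReedSimon1972, Thm. VI.22 (e), Thm. VI.24, PDF pp. 198–199] -/
theorem summable_inner_adjoint_comp_apply_of_mem {ι ι' : Type*} (bV : HilbertBasis ι 𝕜 V)
    (bV' : HilbertBasis ι' 𝕜 V) (A B : E →L[𝕜] F) (hA : Summable fun i => ‖A (bV i : E)‖ ^ 2)
    (hB : Summable fun i => ‖B (bV i : E)‖ ^ 2) :
    Summable (fun j => ⟪(bV' j : E), (ContinuousLinearMap.adjoint A ∘L B) (bV' j : E)⟫_𝕜) ∧
      ∑' j, ⟪(bV' j : E), (ContinuousLinearMap.adjoint A ∘L B) (bV' j : E)⟫_𝕜 =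
        ∑' i, ⟪A (bV i : E), B (bV i : E)⟫_𝕜 := by
  have hkey : ∀ j, ⟪(bV' j : E), (ContinuousLinearMap.adjoint A ∘L B) (bV' j : E)⟫_𝕜 =
      ⟪A (bV' j : E), B (bV' j : E)⟫_𝕜 := fun j => by
    rw [ContinuousLinearMap.comp_apply, ContinuousLinearMap.adjoint_inner_right]
  simp_rw [hkey]
  exact ⟨summable_inner_apply_apply_of_mem bV bV' A B hA hB,
    (tsum_inner_apply_apply_eq_of_hilbertBasis_of_mem bV bV' A B hA hB).symm⟩

end Subspace

end Literature.Analysis.OperatorTheory
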